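import Summits.HodgeConjecture.HodgeConjecture.Theorems.MarkmanPartnerTransportK3Sq2KugaSatakeMixedMultiplier
import Summits.HodgeConjecture.HodgeConjecture.Theorems.MarkmanPartnerTransportK3Sq2KugaSatakeMixedTranspose
import Literature.AlgebraicGeometry.Motives.HodgeStructureK3RealMultProofs

/-!
# Route MarkmanPartnerTransport · support `PartnerTransport` (stmt-HodgeConjecture-19650) ∕ crux #4 — programme
# «KS-MIXED», step M4: A RATIONAL TRANSCENDENTAL HODGE SIMILITUDE `H²(S) → H²(X)` (K3-type SURFACE → marked
# `K3^{[2]}`-type FOURFOLD) IS ALGEBRAIC ON `T(S)`, GRANTED KUGA–SATAKE ON BOTH SIDES AND CHARLES–MARKMAN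

Varesco's Cor. 4.6 in the MIXED case, proved in the kernel by the argument of gen 15's
`KugaSatakePair.exists_algebraicCorrespondence_eq_of_similitude_of_kugaSatake₂` (two surfaces) and
`KugaSatakeHK.exists_algebraicCorrespondence_eq_on_bbfTransc_of_kugaSatake'` (one fourfold): presentations of `S`
on `(T, P, ε)` and of `X` on `(T, m·P)` (`…MixedMultiplier`), ONE Kuga–Satake variety
(`exists_two_correspondences_of_kugaSatake_mixed`), the Lefschetz–transpose into `X` through `B(X)`
(`exists_lefschetzTranspose_toFourfold_of_charlesMarkman`), rational descent `a₂ ∘ g_T = a₁ ≠ 0` with `a₂`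
cycle-induced in the FIELD `End_Hdg(T(X)_ℚ)` (Zarhin) and `a₁` induced by correspondences `S → X`, subfield trick.
Single theorem `exists_algebraicCorrespondence_eq_of_similitude_of_kugaSatake_SX`.

CONDITIONAL on the two Kuga–Satake hypotheses (open in print) and the Charles–Markman record; THEOREMS ONLY; no
sorry, no definition, no new named fact; nothing here says HC or any item is proved. Prover seat
hodge-nonav-19652-p1 (gen 16), `--supports stmt-HodgeConjecture-19650`.

References: M. Varesco, Math. Z. 305 (2023) §0.3, Thm. 4.5, Cor. 4.6, Rem. 5.5; F. Charles, E. Markman, Compos.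
Math. 149 (2013) Thm. 1.1; Yu. Zarhin, J. reine angew. Math. 341 (1983) Thm. 1.5.1; S. Floccari, arXiv:2210.02948 §5.1.
-/

set_option linter.dupNamespace false

noncomputable section

namespace Summit.HodgeConjecture.HodgeConjecture.Theorems.MarkmanPartnerTransport.KugaSatakeMixed

open scoped TensorProduct
open CategoryTheory MonoidalCategory Literature.AlgebraicGeometry Literature.AlgebraicGeometry.Motives
open Literature.AlgebraicGeometry.HodgeTheory Literature.AlgebraicTopology.SingularHomology
open Literature.AlgebraicGeometry.Motives.HodgeStructure Literature.AlgebraicGeometry.Hyperkaehler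
open Literature.AlgebraicGeometry.Surfaces
open Summit.HodgeConjecture.HodgeConjecture.Ring2.AbelianAll
open Summit.HodgeConjecture.HodgeConjecture.Theorems.OddPrimeSquares
open Summit.HodgeConjecture.HodgeConjecture.Theorems.NikulinTwinTransport
open Summit.HodgeConjecture.HodgeConjecture.Theorems.MarkmanPartnerTransport.TranscendentalPresentation
open Summit.HodgeConjecture.HodgeConjecture.Theorems.MarkmanPartnerTransport.KugaSatakeSelf
open Summit.HodgeConjecture.HodgeConjecture.Theorems.MarkmanPartnerTransport.KugaSatakePair
open Summit.HodgeConjecture.HodgeConjecture.Theorems.MarkmanPartnerTransport.KugaSatakeHK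

variable {S X : SchemeOver ℂ} {φ : complexBetti X 2 ≃ₗ[ℂ] (K3HilbertIndex → ℂ)} {PX : complexBetti X (2 * 4)}
  {z : K3HilbertIndex → ℂ}

/-- `MarkedK3Sq[X, φ, P, z]`: VERBATIM the `let MarkedK3Sq := …` binder of the route declarations of
MarkmanPartnerTransport (clauses (m1)–(m6)). Local notation only. -/
local notation3 (prettyPrint := false) "MarkedK3Sq[" X ", " φ ", " P ", " z "]" =>
  (((IsIntegralClass P ∧ ∀ Q : complexBetti X (2 * 4), IsIntegralClass Q → ∃ n : ℤ, Q = n • P) ∧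
    (∀ c : complexBetti X 2, IsIntegralClass c ↔ ∃ v : K3HilbertIndex → ℤ, φ c = fun i => (v i : ℂ)) ∧
    (∀ a : complexBetti X 2, cupPowTwo a 4 = ((3 : ℂ) * (k3HilbertForm 2 (φ a) (φ a)) ^ 2) • P) ∧
    (IsOfHodgeType 4 X 2 2 0 (LinearEquiv.symm φ z) ∧
      ∀ τ : complexBetti X 2, IsOfHodgeType 4 X 2 2 0 τ → ∃ t : ℂ, τ = t • LinearEquiv.symm φ z) ∧
    (∀ c : complexBetti X 2, IsOfHodgeType 4 X 2 1 1 c ↔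
      (k3HilbertForm 2 (φ c) z = 0 ∧ k3HilbertForm 2 (φ c) (star z) = 0)) ∧
    (k3HilbertForm 2 z z = 0 ∧ 0 < (k3HilbertForm 2 (star z) z).re)))

/-- `H²[hS]`: the weight-two `ℚ`-Hodge structure on `H²(S(ℂ); ℚ)` of the real Hodge model of the surface `S`. -/
local notation3 "H²[" hS "]" =>
  bettiTwoHodgeStructure hS (BettiUniverse.realHodgeModel exists_isReal_hodgeModel_holds hS)
    (BettiUniverse.realHodgeModel_isHodgeSymmetric exists_isReal_hodgeModel_holds hS)

/-- `T[hS] = T(S)_ℚ = Hdg¹^⊥ ⊆ H²(S(ℂ); ℚ)`. -/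
local notation3 "T[" hS "]" =>
  transcendentalLatticeBetti hS (BettiUniverse.realHodgeModel exists_isReal_hodgeModel_holds hS)
    (BettiUniverse.realHodgeModel_isHodgeSymmetric exists_isReal_hodgeModel_holds hS)

/-- `H²_B[hX]`: the weight-two `ℚ`-Hodge structure on `H²(X(ℂ); ℚ)` of the real Hodge model of the fourfold `X`. -/
local notation3 "H²_B[" hX "]" =>
  bettiTwoHodgeStructureOfModel hX (BettiUniverse.realHodgeModel exists_isReal_hodgeModel_holds hX)
    (BettiUniverse.realHodgeModel_isHodgeSymmetric exists_isReal_hodgeModel_holds hX)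

/-- `Θ : ℂ ⊗_ℚ H²(Y(ℂ); ℚ) → H²(Y(ℂ); ℂ)` (`Y = S` or `X`). -/
local notation3 "Θ[" Y "]" => ofRatClassBaseChange (Motives.ComplexPoints Y) (2 * 1)

/-- `ι : H²(Y(ℂ); ℚ) → H²(Y(ℂ); ℂ)`, the rational lattice. -/
local notation3 "ι[" Y "]" => ofRatClass (Motives.ComplexPoints Y) (2 * 1)

/-- `Transc[S, y]`: `y` is cup-orthogonal to `N¹(S) = algebraicClasses S 1`. -/
local notation3 (prettyPrint := false) "Transc[" S ", " y "]" =>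
  (∀ d ∈ algebraicClasses S 1, cupProduct (rfl : 2 * 1 + 2 * 1 = 2 * 2) y d = 0)

/-- `BBF[X, φ, y]`: `y` is `q`-orthogonal to `N¹(X) = algebraicClasses X 1`. -/
local notation3 (prettyPrint := false) "BBF[" X ", " φ ", " y "]" =>
  (∀ e : complexBetti X 2, e ∈ algebraicClasses X 1 → k3HilbertForm 2 (φ y) (φ e) = 0)

/-! ### The theorem -/

set_option maxHeartbeats 400000 in
/-- **A RATIONAL TRANSCENDENTAL HODGE SIMILITUDE `H²(S) → H²(X)` IS ALGEBRAIC ON `T(S)`, GRANTED KUGA–SATAKE FOR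
`S` AND `X` AND CHARLES–MARKMAN** (Varesco's Cor. 4.6, K3-type surface → marked `K3^{[2]}`-type fourfold). Data: `S`
with `(2,0)`-classes the line `ℂσ ≠ 0` and `IsKSCorrespondenceAlgebraicBetti` (HYPOTHESIS); `(X, φ, P, z)` marked with
`IsKSCorrespondenceAlgebraicHK 2` (HYPOTHESIS); `g` rational, type-preserving, with `q`-transcendental image, injective
on `T(S)_ℂ`, onto `T(X)_ℂ`, `q(φ g y, φ g w) = μ ∫_S y ∪ w` on `T(S)_ℂ`, `μ ≠ 0` (the route's (g5) is `μ = (∫_S p)⁻¹`).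
Conclusion: some `Φ : H²(S) → H²(X)` INDUCED BY AN ALGEBRAIC CYCLE on `X × S` equals `g` on `T(S)_ℂ`. CONDITIONAL.
[cite: Varesco2023, Cor. 4.6, Thm. 4.5 and §0.3] [cite: CharlesMarkman2013, Thm. 1.1 (§1)]
[cite: Zarhin1983HodgeGroupsK3, Thm. 1.5.1] [cite: Floccari2024, §5.1] -/
theorem exists_algebraicCorrespondence_eq_of_similitude_of_kugaSatake_SX
    (hCM : CharlesMarkman2013_lefschetzStandard_K3HilbertType)
    (hS : IsSmoothProjective 2 S) {σ : complexBetti S (2 * 1)} (hσ : IsOfHodgeType 2 S (2 * 1) 2 0 σ) (hσ0 : σ ≠ 0)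
    (hline : ∀ c : complexBetti S (2 * 1), IsOfHodgeType 2 S (2 * 1) 2 0 c → ∃ t : ℂ, c = t • σ)
    (hX : IsSmoothProjective (2 * 2) X) (hK : IsOfK3HilbertSquareType X) (hM : MarkedK3Sq[X, φ, PX, z])
    (hKS : IsKSCorrespondenceAlgebraicBetti hS) (hKSX : IsKSCorrespondenceAlgebraicHK 2 hX)
    (g : complexBetti S (2 * 1) →ₗ[ℂ] complexBetti X 2)
    (h1 : ∀ y, IsRationalClass y → IsRationalClass (g y))
    (h2 : ∀ (i j : ℕ) y, IsOfHodgeType 2 S (2 * 1) i j y → IsOfHodgeType 4 X 2 i j (g y))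
    (h4 : ∀ y : complexBetti S (2 * 1), BBF[X, φ, g y])
    (hinj : ∀ y : complexBetti S (2 * 1), Transc[S, y] → g y = 0 → y = 0)
    (hsurj : ∀ y' : complexBetti X 2, BBF[X, φ, y'] → ∃ y, Transc[S, y] ∧ g y = y')
    {μ : ℂ} (hμ : μ ≠ 0)
    (hmul : ∀ y w : complexBetti S (2 * 1), Transc[S, y] → Transc[S, w] →
      k3HilbertForm 2 (φ (g y)) (φ (g w)) = μ * traceC hS (cupProduct (rfl : 2 * 1 + 2 * 1 = 2 * 2) y w)) :
    ∃ Φ : complexBetti S (2 * 1) →ₗ[ℂ] complexBetti X 2, IsAlgebraicCorrespondence 4 2 X S Φ ∧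
      ∀ y : complexBetti S (2 * 1), Transc[S, y] → Φ y = g y := by
  classical
  have hX4 : IsSmoothProjective 4 X := hX
  haveI := BettiUniverse.finite hS (2 * 1); haveI := BettiUniverse.finite hX (2 * 1)
  -- the presentations of `S` and `X`
  obtain ⟨T, P, ε, hT, -, hirr, hK3, hj⟩ := exists_isTranscendentalPartBetti_trPart hS hσ hσ0 hline
  obtain ⟨b, T', Pol, hb, hbq, hirr', hK3T', htr', -, hj'⟩ := exists_isTranscendentalPartHK hX hM
  haveI := Module.Finite.of_injective T.toSubmodule.subtype T.toSubmodule.injective_subtype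
  haveI := Module.Finite.of_injective T'.toSubmodule.subtype T'.toSubmodule.injective_subtype
  have hT' := mem_toSubmodule_iff_of_isTranscendentalPartHK hX hbq hj'
  -- `g_T : Hom T T'`, bijective
  obtain ⟨gT, hgT⟩ := exists_hom_transcendental_SX hS hX T T' hT' g h1 h2 h4
  have hbij : Function.Bijective gT.toLinearMap := hom_transcendental_bijective_SX hT hT' hgT hinj hsurj
  -- `σ = Θ(sub x₀)`, `x₀ ≠ 0`, `T ≠ 0`
  obtain ⟨x₀, hx₀⟩ := exists_baseChange_eq_of_transc hS T hT (transc_of_twoZero hS hσ)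
  have hx₀0 : x₀ ≠ 0 := by rintro rfl; exact hσ0 (by rw [← hx₀, map_zero, map_zero])
  have hT0 : T.toSubmodule ≠ ⊥ := Submodule.nontrivial_iff_ne_bot.1 hirr.1
  -- the rational POSITIVE multiplier and the mixed presentation of `X` on `(T, m·P)`
  obtain ⟨m, hm0, hmulQ⟩ := exists_rat_multiplier_SX hS hX hT hj hT0 hbq hj' hgT hμ hmul
  have hm : 0 < m := multiplier_pos_of_hom P Pol gT hbij.1 (piece_two_zero_ne_bot_of_isOfK3Type hK3) hmulQ
  have hjX := isTranscendentalPartHK_transport_SX hX hj' hbij hm hmulQ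
  -- the two correspondences into one Kuga–Satake square
  obtain ⟨A, μK, O₁, O₂, hμK, hO₁, hO₂, hO₁j, hO₂j⟩ :=
    exists_two_correspondences_of_kugaSatake_mixed hS hX hKS hKSX hb hj hK3 hm hjX
  have hA : IsSmoothProjective A.dim A.X := AbelianVariety.isSmoothProjective_holds
  have hY : IsSmoothProjective (A.dim + A.dim) (A.X ⊗ A.X) := hA.tensor_holds hA
  have hn : 2 ≤ A.dim + A.dim := by have h := IsAlgebraicCorrespondence.le_two_mul hO₁; omega
  have hO₂' : IsAlgebraicCorrespondence (A.dim + A.dim) 4 (A.X ⊗ A.X) X O₂ := hO₂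
  -- the Lefschetz–transpose into `X`, through `B(X)`
  obtain ⟨R, hΦ₁, hΦ₂, hne⟩ := exists_lefschetzTranspose_toFourfold_of_charlesMarkman hCM hX4 hK hY hn hS hO₁ hO₂'
  -- `j'' = ι_{T'} ∘ g_T` and its complexification
  set j'' : T.toSubmodule →ₗ[ℚ] bettiCohomology X (2 * 1) := T'.toSubmodule.subtype ∘ₗ gT.toLinearMap with hj''
  have hψx : ∀ x : ℂ ⊗[ℚ] T.toSubmodule, g (Θ[S] (T.toSubmodule.subtype.baseChange ℂ x)) =
      Θ[X] (j''.baseChange ℂ x) := by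
    intro x
    induction x using TensorProduct.induction_on with
    | zero => simp only [map_zero]
    | tmul c t =>
      rw [LinearMap.baseChange_tmul, Submodule.subtype_apply, ofRatClassBaseChange_tmul, map_smul,
        LinearMap.baseChange_tmul, ofRatClassBaseChange_tmul, hj'', LinearMap.comp_apply, Submodule.subtype_apply, hgT]
    | add x y hx hy => simp only [map_add, hx, hy]
  -- `O₁` on `Θ(T_ℂ)` and `O₂` on `Θ_X(j''(T)_ℂ)`
  have hO₁x : ∀ x : ℂ ⊗[ℚ] T.toSubmodule, O₁ (Θ[S] (T.toSubmodule.subtype.baseChange ℂ x)) =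
      ofRatClassBaseChange (Motives.ComplexPoints (A.X ⊗ A.X)) 2 (μK.baseChange ℂ x) := by
    intro x
    induction x using TensorProduct.induction_on with
    | zero => simp only [map_zero]
    | tmul c t =>
      rw [LinearMap.baseChange_tmul, Submodule.subtype_apply, ofRatClassBaseChange_tmul, map_smul,
        LinearMap.baseChange_tmul, ofRatClassBaseChange_tmul]
      exact congrArg _ (hO₁j t)
    | add x y hx hy => simp only [map_add, hx, hy]
  have hO₂x : ∀ x : ℂ ⊗[ℚ] T.toSubmodule, O₂ (Θ[X] (j''.baseChange ℂ x)) =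
      ofRatClassBaseChange (Motives.ComplexPoints (A.X ⊗ A.X)) 2 (μK.baseChange ℂ x) := by
    intro x
    induction x using TensorProduct.induction_on with
    | zero => simp only [map_zero]
    | tmul c t =>
      rw [LinearMap.baseChange_tmul, ofRatClassBaseChange_tmul, map_smul, LinearMap.baseChange_tmul,
        ofRatClassBaseChange_tmul]
      exact congrArg _ (hO₂j t)
    | add x y hx hy => simp only [map_add, hx, hy]
  have hμC : Function.Injective (μK.baseChange ℂ) := by
    rw [LinearMap.baseChange_eq_ltensor]
    exact Module.Flat.lTensor_preserves_injective_linearMap _ hμK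
  -- `O₂ (gσ)` is a non-zero `(2,0)`-class with `O₂ \bar{gσ} = \overline{O₂ gσ}`
  have hO₂σ0 : O₂ (g σ) ≠ 0 := by
    rw [← hx₀, hψx, hO₂x]
    exact fun h0 => hx₀0 (hμC (ofRatClassBaseChange_injective _ _ (by rw [h0, map_zero, map_zero])))
  have hO₂conj : O₂ (conjClass _ (2 * 1) (g σ)) = conjClass _ 2 (O₂ (g σ)) := by
    rw [← hx₀, hψx, ← ofRatClassBaseChange_conj_eq₄ hX, conj_baseChange, hO₂x, hO₂x, ← conj_baseChange]
    exact KaehlerRationalDatum.ofRatClassBaseChange_conj hY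
      (BettiUniverse.realHodgeModel exists_isReal_hodgeModel_holds hY) _
  have hΦ₂σ : (R ∘ₗ O₂) (g σ) ≠ 0 :=
    hne (g σ) (isOfHodgeType_two_zero_of_isAlgebraicCorrespondenceHK hY hX4 hO₂' (h2 _ _ _ hσ)) hO₂σ0 hO₂conj
  -- `O₁ σ = O₂ (g σ)`, so `f₁ σ ≠ 0`
  have hO₁σ : O₁ σ = O₂ (g σ) := by rw [← hx₀, hO₁x, hψx, hO₂x]
  have hΦ₁σ : (R ∘ₗ O₁) σ ≠ 0 := by rw [LinearMap.comp_apply, hO₁σ]; exact hΦ₂σ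
  -- `f₂ ∘ g = f₁` on `T(S)_ℚ`
  have hrel : ∀ t : T.toSubmodule, (R ∘ₗ O₂) (g (ι[S] (t : bettiCohomology S (2 * 1)))) =
      (R ∘ₗ O₁) (ι[S] (t : bettiCohomology S (2 * 1))) := by
    intro t
    rw [LinearMap.comp_apply, LinearMap.comp_apply, ← hgT]
    exact congrArg R ((hO₂j t).trans (hO₁j t).symm)
  -- the cycle-induced Hodge endomorphisms of `T'` (self-correspondences of `X`)
  let Rs : Submodule ℚ (Module.End ℚ T'.toSubmodule) :=
    { carrier := {a | a ∈ T'.toHodgeStructure.endAlg ∧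
        ∃ f : complexBetti X 2 →ₗ[ℂ] complexBetti X 2, IsAlgebraicCorrespondence 4 4 X X f ∧
          ∀ t : T'.toSubmodule, f (ι[X] (t : bettiCohomology X (2 * 1))) =
            ι[X] ((a t : T'.toSubmodule) : bettiCohomology X (2 * 1))}
      add_mem' := by
        rintro a a' ⟨haE, f, hf, hfa⟩ ⟨hbE, f', hf', hfb⟩
        refine ⟨add_mem haE hbE, f + f', IsAlgebraicCorrespondence.add hX4 hX4 hf hf', fun t => ?_⟩
        rw [LinearMap.add_apply, hfa, hfb, LinearMap.add_apply, Submodule.coe_add, map_add]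
      zero_mem' := by
        refine ⟨zero_mem _, 0, isAlgebraicCorrespondence_zero hX4 hX4 (e := 4) rfl (by norm_num), fun t => ?_⟩
        rw [LinearMap.zero_apply, LinearMap.zero_apply, Submodule.coe_zero, map_zero]
      smul_mem' := by
        rintro c a ⟨haE, f, hf, hfa⟩
        refine ⟨Subalgebra.smul_mem _ haE c, (c : ℂ) • f, IsAlgebraicCorrespondence.smul hX4 hX4 hf _, fun t => ?_⟩
        rw [LinearMap.smul_apply, hfa, LinearMap.smul_apply, Submodule.coe_smul, Motives.ofRatClass_smul] }
  have hRsE : ∀ a ∈ Rs, a ∈ T'.toHodgeStructure.endAlg := fun a ha => ha.1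
  have hRsmul : ∀ a ∈ Rs, ∀ a' ∈ Rs, a * a' ∈ Rs := by
    rintro a ⟨haE, f, hf, hfa⟩ a' ⟨hbE, f', hf', hfb⟩
    refine ⟨mul_mem haE hbE, f ∘ₗ f', IsAlgebraicCorrespondence.comp hX4 hX4 hX4 hf' hf (by norm_num), fun t => ?_⟩
    rw [LinearMap.comp_apply, hfb, hfa, Module.End.mul_apply]
  -- the `ℚ`-linear maps `T → T'` induced by algebraic correspondences `S → X`
  let Hs : Submodule ℚ (T.toSubmodule →ₗ[ℚ] T'.toSubmodule) :=
    { carrier := {a | ∃ f : complexBetti S (2 * 1) →ₗ[ℂ] complexBetti X 2, IsAlgebraicCorrespondence 4 2 X S f ∧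
          ∀ t : T.toSubmodule, f (ι[S] (t : bettiCohomology S (2 * 1))) =
            ι[X] ((a t : T'.toSubmodule) : bettiCohomology X (2 * 1))}
      add_mem' := by
        rintro a a' ⟨f, hf, hfa⟩ ⟨f', hf', hfb⟩
        refine ⟨f + f', IsAlgebraicCorrespondence.add hX4 hS hf hf', fun t => ?_⟩
        rw [LinearMap.add_apply, hfa, hfb, LinearMap.add_apply, Submodule.coe_add, map_add]
      zero_mem' := by
        refine ⟨0, isAlgebraicCorrespondence_zero hX4 hS (e := 2) rfl (by norm_num), fun t => ?_⟩
        rw [LinearMap.zero_apply, LinearMap.zero_apply, Submodule.coe_zero, map_zero]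
      smul_mem' := by
        rintro c a ⟨f, hf, hfa⟩
        refine ⟨(c : ℂ) • f, IsAlgebraicCorrespondence.smul hX4 hS hf _, fun t => ?_⟩
        rw [LinearMap.smul_apply, hfa, LinearMap.smul_apply, Submodule.coe_smul, Motives.ofRatClass_smul] }
  have hHsmul : ∀ a ∈ Hs, ∀ a' ∈ Rs, a' ∘ₗ a ∈ Hs := by
    rintro a ⟨f, hf, hfa⟩ a' ⟨-, f', hf', hfb⟩
    refine ⟨f' ∘ₗ f, IsAlgebraicCorrespondence.comp hX4 hX4 hS hf hf' (by norm_num), fun t => ?_⟩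
    rw [LinearMap.comp_apply, hfa, hfb, LinearMap.comp_apply]
  -- `Θ_X` as an equivalence, and the retractions `(r ⊗ 1) ∘ Θ_X⁻¹`
  let Θe : (ℂ ⊗[ℚ] bettiCohomology X (2 * 1)) ≃ₗ[ℂ] complexBetti X (2 * 1) :=
    LinearEquiv.ofBijective (Θ[X]) ⟨ofRatClassBaseChange_injective _ _, ofRatClassBaseChange_surjective hX (2 * 1)⟩
  have hΘe : ∀ x, Θe x = Θ[X] x := fun _ => rfl
  have hΘe_symm : ∀ (c : ℂ) (w : bettiCohomology X (2 * 1)), Θe.symm (c • ι[X] w) = c ⊗ₜ[ℚ] w := by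
    intro c w
    apply Θe.injective
    rw [LinearEquiv.apply_symm_apply, hΘe, ofRatClassBaseChange_tmul]
  -- DESCENT (self, on `X`): `(r ⊗ 1) Θ⁻¹ f ι` is a cycle-induced Hodge endomorphism of `T'`
  have hdesc : ∀ (r : ℂ →ₗ[ℚ] ℚ) {f : complexBetti X 2 →ₗ[ℂ] complexBetti X 2},
      IsAlgebraicCorrespondence 4 4 X X f → ∃ a ∈ Rs, ∀ t : T'.toSubmodule,
        TensorProduct.lid ℚ _ (r.rTensor _ (Θe.symm (f (ι[X] (t : bettiCohomology X (2 * 1)))))) =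
          ((a t : T'.toSubmodule) : bettiCohomology X (2 * 1)) := by
    intro r f hf
    obtain ⟨e, hab, γ, hγ, rfl⟩ := IsAlgebraicCorrespondence.exists_eq_corrAction hX4 hX4 hf
    suffices h : ∀ c : ℂ, ∃ a ∈ Rs, ∀ t : T'.toSubmodule,
        TensorProduct.lid ℚ _ (r.rTensor _ (Θe.symm
          (c • corrAction complexOrientationFamily hX4 hX4 hab γ (ι[X] (t : bettiCohomology X (2 * 1)))))) =
          ((a t : T'.toSubmodule) : bettiCohomology X (2 * 1)) by
      obtain ⟨a, ha, h1⟩ := h 1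
      exact ⟨a, ha, fun t => by rw [← h1 t, one_smul]⟩
    have hγ' := (le_of_eq (supportedClasses_eq_span_isRationalClass (hX4.tensor_holds hX4) (2 * e) e)) hγ
    clear hf hγ
    induction hγ' using Submodule.span_induction with
    | mem γ hγQ =>
      intro c
      obtain ⟨a, haE, ha⟩ := exists_endAlg_of_isRationalClassHK hX T' htr' hirr' hK3T' hab hγQ.2 hγQ.1
      have haR : a ∈ Rs :=
        ⟨haE, _, isAlgebraicCorrespondence_corrAction_complex hX4 hX4 hab (by norm_num) hγQ.2, ha⟩
      refine ⟨r c • a, Rs.smul_mem _ haR, fun t => ?_⟩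
      rw [ha t, hΘe_symm, lid_rTensor_tmul, LinearMap.smul_apply, Submodule.coe_smul]
    | zero =>
      intro c
      refine ⟨0, Rs.zero_mem, fun t => ?_⟩
      rw [map_zero, LinearMap.zero_apply, smul_zero, map_zero, map_zero, map_zero, LinearMap.zero_apply,
        Submodule.coe_zero]
    | add γ γ' _ _ h h' =>
      intro c
      obtain ⟨a, ha, hat⟩ := h c
      obtain ⟨a', ha', hat'⟩ := h' c
      refine ⟨a + a', Rs.add_mem ha ha', fun t => ?_⟩
      rw [map_add, LinearMap.add_apply, smul_add, map_add, map_add, map_add, hat, hat', LinearMap.add_apply,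
        Submodule.coe_add]
    | smul c' γ _ h =>
      intro c
      obtain ⟨a, ha, hat⟩ := h (c * c')
      refine ⟨a, ha, fun t => ?_⟩
      rw [(corrAction complexOrientationFamily hX4 hX4 hab).map_smul, LinearMap.smul_apply, smul_smul]
      exact hat t
  -- DESCENT (cross): `(r ⊗ 1) Θ_X⁻¹ f ι_S` is induced by algebraic correspondences `S → X`
  have hdescX : ∀ (r : ℂ →ₗ[ℚ] ℚ) {f : complexBetti S (2 * 1) →ₗ[ℂ] complexBetti X 2},
      IsAlgebraicCorrespondence 4 2 X S f → ∃ a ∈ Hs, ∀ t : T.toSubmodule,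
        TensorProduct.lid ℚ _ (r.rTensor _ (Θe.symm (f (ι[S] (t : bettiCohomology S (2 * 1)))))) =
          ((a t : T'.toSubmodule) : bettiCohomology X (2 * 1)) := by
    intro r f hf
    obtain ⟨e, hab, γ, hγ, rfl⟩ := IsAlgebraicCorrespondence.exists_eq_corrAction hX4 hS hf
    suffices h : ∀ c : ℂ, ∃ a ∈ Hs, ∀ t : T.toSubmodule,
        TensorProduct.lid ℚ _ (r.rTensor _ (Θe.symm
          (c • corrAction complexOrientationFamily hX4 hS hab γ (ι[S] (t : bettiCohomology S (2 * 1)))))) =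
          ((a t : T'.toSubmodule) : bettiCohomology X (2 * 1)) by
      obtain ⟨a, ha, h1⟩ := h 1
      exact ⟨a, ha, fun t => by rw [← h1 t, one_smul]⟩
    have hγ' := (le_of_eq (supportedClasses_eq_span_isRationalClass (hX4.tensor_holds hS) (2 * e) e)) hγ
    clear hf hγ
    induction hγ' using Submodule.span_induction with
    | mem γ hγQ =>
      intro c
      obtain ⟨a, ha⟩ := exists_homAlg_of_isRationalClass_SX hS hX T hirr hK3 T' htr' hab hγQ.2 hγQ.1
      have haR : a.toLinearMap ∈ Hs :=
        ⟨_, isAlgebraicCorrespondence_corrAction_complex hX4 hS hab (by norm_num) hγQ.2, ha⟩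
      refine ⟨r c • a.toLinearMap, Hs.smul_mem _ haR, fun t => ?_⟩
      rw [ha t, hΘe_symm, lid_rTensor_tmul, LinearMap.smul_apply, Submodule.coe_smul]
    | zero =>
      intro c
      refine ⟨0, Hs.zero_mem, fun t => ?_⟩
      rw [map_zero, LinearMap.zero_apply, smul_zero, map_zero, map_zero, map_zero, LinearMap.zero_apply,
        Submodule.coe_zero]
    | add γ γ' _ _ h h' =>
      intro c
      obtain ⟨a, ha, hat⟩ := h c
      obtain ⟨a', ha', hat'⟩ := h' c
      refine ⟨a + a', Hs.add_mem ha ha', fun t => ?_⟩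
      rw [map_add, LinearMap.add_apply, smul_add, map_add, map_add, map_add, hat, hat', LinearMap.add_apply,
        Submodule.coe_add]
    | smul c' γ _ h =>
      intro c
      obtain ⟨a, ha, hat⟩ := h (c * c')
      refine ⟨a, ha, fun t => ?_⟩
      rw [(corrAction complexOrientationFamily hX4 hS hab).map_smul, LinearMap.smul_apply, smul_smul]
      exact hat t
  -- a rational vector of `T` where `f₁` does not vanish, and a retraction detecting it
  have hzero_or : ∃ t₀ : T.toSubmodule, (R ∘ₗ O₁) (ι[S] (t₀ : bettiCohomology S (2 * 1))) ≠ 0 := by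
    by_contra hall
    push Not at hall
    have hzero : ∀ x : ℂ ⊗[ℚ] T.toSubmodule, (R ∘ₗ O₁) (Θ[S] (T.toSubmodule.subtype.baseChange ℂ x)) = 0 := by
      intro x
      induction x using TensorProduct.induction_on with
      | zero => rw [map_zero, map_zero, map_zero]
      | tmul c t =>
        rw [LinearMap.baseChange_tmul, Submodule.subtype_apply, ofRatClassBaseChange_tmul, map_smul, hall t,
          smul_zero]
      | add x y hx hy => rw [map_add, map_add, map_add, hx, hy, add_zero]
    exact hΦ₁σ (by rw [← hx₀]; exact hzero x₀)
  obtain ⟨t₀, ht₀⟩ := hzero_or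
  have hξ : Θe.symm ((R ∘ₗ O₁) (ι[S] (t₀ : bettiCohomology S (2 * 1)))) ≠ 0 := fun h0 => by
    have h := congrArg Θe h0; rw [LinearEquiv.apply_symm_apply, map_zero] at h; exact ht₀ h
  obtain ⟨r, hr⟩ := exists_rat_retraction_ne_zero hξ
  -- the descended maps `a₁ ∈ Hs`, `a₂ ∈ Rs` with `a₂ ∘ g_T = a₁ ≠ 0`
  obtain ⟨a₁, ha₁R, ha₁⟩ := hdescX r hΦ₁
  obtain ⟨a₂, ha₂R, ha₂⟩ := hdesc r hΦ₂
  have ha₁0 : a₁ ≠ 0 := fun h0 => hr (by rw [ha₁ t₀, h0, LinearMap.zero_apply, Submodule.coe_zero])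
  have hmulrel : a₂ ∘ₗ gT.toLinearMap = a₁ := by
    refine LinearMap.ext fun t => Subtype.ext ?_
    rw [LinearMap.comp_apply, ← ha₂, ← ha₁, hgT, hrel t]
  have ha₂0 : a₂ ≠ 0 := by rintro rfl; exact ha₁0 (by rw [← hmulrel, LinearMap.zero_comp])
  -- Zarhin: `End_Hdg(T(X)_ℚ)` is a field; the inverse of `a₂` lies in `Rs` by the subfield trick
  obtain ⟨hField, -⟩ := Zarhin1983_endAlg_isField_holds T'.toHodgeStructure hirr' hK3T'
  have ha₂E : a₂ ∈ T'.toHodgeStructure.endAlg := hRsE _ ha₂R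
  obtain ⟨ai, hai⟩ := hField.mul_inv_cancel (show (⟨a₂, ha₂E⟩ : T'.toHodgeStructure.endAlg) ≠ 0 from
    fun h0 => ha₂0 (congrArg Subtype.val h0))
  have hab : a₂ * (ai : Module.End ℚ T'.toSubmodule) = 1 := by
    have h := congrArg Subtype.val hai
    simpa only [Subalgebra.coe_mul, Subalgebra.coe_one] using h
  have hba : (ai : Module.End ℚ T'.toSubmodule) * a₂ = 1 := by
    rw [hField.mul_comm ⟨a₂, ha₂E⟩ ai] at hai
    have h := congrArg Subtype.val hai
    simpa only [Subalgebra.coe_mul, Subalgebra.coe_one] using h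
  have haiR : (ai : Module.End ℚ T'.toSubmodule) ∈ Rs :=
    mem_of_mul_eq_of_isField hField Rs hRsE hRsmul ha₂R (hRsmul _ ha₂R _ ha₂R) ai.2 ha₂0
      (by rw [mul_assoc, hab]; exact mul_one a₂)
  obtain ⟨-, f₃, hf₃, hf₃b⟩ := haiR
  obtain ⟨f₁, hf₁, hf₁a⟩ := ha₁R
  -- `Φ = f₃ ∘ f₁`
  refine ⟨f₃ ∘ₗ f₁, IsAlgebraicCorrespondence.comp hX4 hX4 hS hf₁ hf₃ (by norm_num), fun y hy => ?_⟩
  have hpt : ∀ t : T.toSubmodule, (f₃ ∘ₗ f₁) (ι[S] (t : bettiCohomology S (2 * 1))) =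
      g (ι[S] (t : bettiCohomology S (2 * 1))) := by
    intro t
    rw [LinearMap.comp_apply, hf₁a, hf₃b, ← hgT]
    congr 2
    have h := congrArg (fun G : Module.End ℚ T'.toSubmodule => G (gT.toLinearMap t)) hba
    simp only [Module.End.mul_apply, Module.End.one_apply] at h
    rw [← h]
    congr 1
    have h' := congrArg (fun G : T.toSubmodule →ₗ[ℚ] T'.toSubmodule => G t) hmulrel
    simp only [LinearMap.comp_apply] at h'
    exact h'.symm
  obtain ⟨x, rfl⟩ := exists_baseChange_eq_of_transc hS T hT hy
  clear hy
  induction x using TensorProduct.induction_on with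
  | zero => rw [map_zero, map_zero, map_zero, map_zero]
  | tmul c t =>
    rw [LinearMap.baseChange_tmul, Submodule.subtype_apply, ofRatClassBaseChange_tmul, map_smul, map_smul, hpt t]
  | add x y hx hy => rw [map_add, map_add, map_add, map_add, hx, hy]

end Summit.HodgeConjecture.HodgeConjecture.Theorems.MarkmanPartnerTransport.KugaSatakeMixed

end
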